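import Mathlib
import HarnessLib

/-!
# Route `UnthreadedDoor`, crux `PoloidalLiouville` (stmt-NavierStokesRegularity-1222), wall W1 — crux idea
# «flux-starved-dipoles» (ns-idea-15 g12/g13, `Cruxes/PoloidalLiouville/FluxStarvedDipoleSketch.lean`):
# the last step of `FluxStarvationSteady` — constant loop momentum + zero net flux ⇒ tangency

The paper proof of the typed Prop `FluxStarvationSteady` (card §Proof steps 1–3) ends: on a non-solid dipolar sphere `S_r(x₀)`
the loop momentum `m = ⟪u, x − x₀⟫` is CONSTANT (`(a − r a′)·M = −r²ℓ` is latitude-independent), and the net flux of the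
incompressible drift `u` through `S_r(x₀)` vanishes, so `m ≡ 0` there.  THIS FILE isolates that last step as a kernel lemma
with the two analytic inputs as hypotheses, fixing their exact shapes for the remaining work:

`FluxStarvedDipole.tangent_of_loopMomentum_const_of_zeroFlux`: if `⟪u x, x − x₀⟫` takes the same value at all points of
`S_r(x₀)` (`r > 0`) and `∫_{S²} ⟪u(x₀ + rα), α⟫ dσ(α) = 0` (`σ = volume.toSphere`, the surface measure of
`Literature.Analysis.FluidPDE.SphereIntegral`), then `⟪u x, x − x₀⟫ = 0` on `S_r(x₀)`.

Remaining inputs of `FluxStarvationSteady` (not here): (c-3) the latitude-independence `(a − r a′)M = −r²ℓ` from the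
`τ`-component of the steady kinematic law and incompressibility averaged over latitude circles (steps 1–2 are
`…FluxStarvedDipoleLoopLaw`, p837304); (c-4) zero net flux through spheres of a `C¹` divergence-free field (Gauss).
HONEST LABEL: bookkeeping in the linear kinematic shadow of W1 (information-grade, W1 movement 0); `FluxStarvationSteady`, K1,
`PoloidalLiouville` (1222), its wall and the summit stay OPEN; NO Navier–Stokes regularity statement is proved.
`--supports stmt-NavierStokesRegularity-1222` (helper).  [folklore]
-/

noncomputable section

-- the summit and its single sub-problem share the name (CONVENTIONS §1)
set_option linter.dupNamespace false

open Set MeasureTheory Metric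
open scoped RealInnerProductSpace

namespace Summit.NavierStokesRegularity.NavierStokesRegularity.Theorems.PoloidalLiouville.FluxStarvedDipole

/-- **Constant loop momentum + zero net flux ⇒ tangency.**  If `⟪u x, x − x₀⟫` is constant on the sphere `S_r(x₀)`, `r > 0`,
and the flux `∫_{S²} ⟪u(x₀ + rα), α⟫ dσ(α)` vanishes, then `u` is tangent to `S_r(x₀)`. [folklore] -/
theorem tangent_of_loopMomentum_const_of_zeroFlux (u : EuclideanSpace ℝ (Fin 3) → EuclideanSpace ℝ (Fin 3))
    (x₀ : EuclideanSpace ℝ (Fin 3)) {r : ℝ} (hr : 0 < r)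
    (hconst : ∀ x y : EuclideanSpace ℝ (Fin 3), ‖x - x₀‖ = r → ‖y - x₀‖ = r → ⟪u x, x - x₀⟫ = ⟪u y, y - x₀⟫)
    (hflux : ∫ α : sphere (0 : EuclideanSpace ℝ (Fin 3)) 1,
        ⟪u (x₀ + r • (α : EuclideanSpace ℝ (Fin 3))), (α : EuclideanSpace ℝ (Fin 3))⟫
          ∂(volume : Measure (EuclideanSpace ℝ (Fin 3))).toSphere = 0) :
    ∀ x, ‖x - x₀‖ = r → ⟪u x, x - x₀⟫ = 0 := by
  intro x hx
  set M₀ : ℝ := ⟪u x, x - x₀⟫ with hM₀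
  -- on the unit sphere the flux density is the constant `M₀ / r`
  have hdens : ∀ α : sphere (0 : EuclideanSpace ℝ (Fin 3)) 1,
      ⟪u (x₀ + r • (α : EuclideanSpace ℝ (Fin 3))), (α : EuclideanSpace ℝ (Fin 3))⟫ = M₀ / r := by
    intro α
    have hα : ‖(α : EuclideanSpace ℝ (Fin 3))‖ = 1 := norm_eq_of_mem_sphere α
    have hy : ‖(x₀ + r • (α : EuclideanSpace ℝ (Fin 3))) - x₀‖ = r := by
      rw [add_sub_cancel_left, norm_smul, hα, mul_one, Real.norm_eq_abs, abs_of_pos hr]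
    have h := hconst _ _ hy hx
    rw [add_sub_cancel_left, real_inner_smul_right] at h
    rw [hM₀, ← h]
    field_simp
  have hint : ∫ α : sphere (0 : EuclideanSpace ℝ (Fin 3)) 1,
      ⟪u (x₀ + r • (α : EuclideanSpace ℝ (Fin 3))), (α : EuclideanSpace ℝ (Fin 3))⟫
        ∂(volume : Measure (EuclideanSpace ℝ (Fin 3))).toSphere
      = ((volume : Measure (EuclideanSpace ℝ (Fin 3))).toSphere.real univ) * (M₀ / r) := by
    rw [integral_congr_ae (Filter.Eventually.of_forall hdens), integral_const, smul_eq_mul]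
  -- the unit sphere has positive surface measure
  have hpos : 0 < (volume : Measure (EuclideanSpace ℝ (Fin 3))).toSphere.real univ := by
    rw [Measure.toSphere_real_apply_univ]
    have hb : 0 < (volume : Measure (EuclideanSpace ℝ (Fin 3))).real (ball 0 1) := by
      rw [measureReal_def]
      exact ENNReal.toReal_pos (measure_ball_pos volume (0 : EuclideanSpace ℝ (Fin 3)) one_pos).ne'
        measure_ball_lt_top.ne
    have hd : (0 : ℝ) < Module.finrank ℝ (EuclideanSpace ℝ (Fin 3)) := by
      rw [finrank_euclideanSpace_fin]; norm_num
    exact mul_pos hd hb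
  rw [hint] at hflux
  rcases mul_eq_zero.mp hflux with h | h
  · exact absurd h hpos.ne'
  · rcases div_eq_zero_iff.mp h with h' | h'
    · exact h'
    · exact absurd h' hr.ne'

end Summit.NavierStokesRegularity.NavierStokesRegularity.Theorems.PoloidalLiouville.FluxStarvedDipole

end
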